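import Summits.RiemannHypothesis.RiemannHypothesis.Theses.WeilComb
import Summits.RiemannHypothesis.RiemannHypothesis.Theorems.WeilCombCombShapeAdmissible
import Summits.RiemannHypothesis.RiemannHypothesis.Theorems.WeilCombCombShapePositivityBumpCellBounds
import Literature.Barriers.HubbardSuperconductivity.WeakCouplingCeiling
import Literature.NumberTheory.LFunctions.WeilExplicit
import Literature.NumberTheory.LFunctions.WeilArchimedeanMoments
import Literature.NumberTheory.LFunctions.WeilArchimedeanPositivityProofs

/-!
# Termwise bounds for the Bombieri form of the archimedean diagonal: the bump autocorrelation toolkit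
(crux `WeilComb.CombShapePositivity`, item stmt-RiemannHypothesis-11229, line `Sketch`, towards `stub_windowCore`;
siege k2, variation "explicit sums: three-term identity then termwise bounds"; companion of
`…ArchDiagBombieriK2.lean`)

Notation. `φ₀(u) = expNegInvGlue (1 - u²)`, `N = ‖φ₀‖₂²`, `I₀ = ∫ φ₀`, and the real autocorrelation of the bump
`P₀(s) = ∫ φ₀(u) φ₀(u − s) du`, written inline as `∫ u, expNegInvGlue (1 - u ^ 2) * expNegInvGlue (1 - (u - s) ^ 2)`.

This file supplies the ELEMENTARY inputs of the termwise bounds of the exact diagonal identity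
`Re W_∞(ψ_ε) = ε⁻¹N(log coth ε − log 4π − γ) − ∫₀² (e^{εs/2}P₀(s) − N)/sinh(εs) ds` (`re_weilArchTerm_psi_diag_bombieri`):

* hyperbolic/exponential brackets (from `sinh x ≤ x cosh x`, `Literature…sinh_le_self_mul_cosh`):
  `log(1/ε) ≤ log(cosh ε/sinh ε) ≤ log(1/ε) + ε²/2`, `(1 − y²/2)/y ≤ 1/sinh y ≤ 1/y`,
  `y/2 ≤ e^{y/2} − 1 ≤ (y/2)e^{y/2}`;
* the bump autocorrelation: `0 ≤ P₀(s) ≤ N`, `P₀` even, continuous, `P₀(s) = 0` for `|s| > 2`, `∫ P₀ = I₀²`,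
  `∫₀² P₀ = I₀²/2` (`intervalIntegral_bumpAutocorr_eq`), and the Lipschitz bound `N − P₀(s) ≤ K s` on `[0, 2]`.

The assembled two-sided enclosure `Re W_∞(ψ_ε) = ε⁻¹[N(log(1/ε) − log 4π − γ) + 𝒞'] − I₀²/4 + O(ε)`,
`𝒞' = ∫₀²(N − P₀(s))/s ds`, is in `…ArchDiagBombieriEnclosureK2.lean`.
-/

noncomputable section

-- the sub-problem path RiemannHypothesis/RiemannHypothesis duplicates a namespace (D-0017)
set_option linter.dupNamespace false

open scoped BigOperators ComplexConjugate Topology ContDiff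
open Complex MeasureTheory Set Filter

namespace Summit.RiemannHypothesis.RiemannHypothesis.Theorems.WeilCombBohrFejer

open Literature.NumberTheory.LFunctions

/-! ### Hyperbolic and exponential brackets -/

-- `sinh x ≤ x cosh x` for `x ≥ 0` is `Literature.Barriers.HubbardSuperconductivity.sinh_le_self_mul_cosh` (reused).

/-- `log(1/ε) ≤ log(cosh ε / sinh ε)` for `ε > 0` (`tanh ε ≤ ε`). [folklore] -/
theorem log_inv_le_log_coth_diagBB {ε : ℝ} (hε : 0 < ε) :
    Real.log (1 / ε) ≤ Real.log (Real.cosh ε / Real.sinh ε) := by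
  have hsh : 0 < Real.sinh ε := Real.sinh_pos_iff.2 hε
  apply Real.log_le_log (by positivity)
  rw [div_le_div_iff₀ hε hsh, one_mul, mul_comm]
  exact Literature.Barriers.HubbardSuperconductivity.sinh_le_self_mul_cosh hε.le

/-- `log(cosh ε / sinh ε) ≤ log(1/ε) + ε²/2` for `ε > 0` (`sinh ε ≥ ε`, `cosh ε ≤ e^{ε²/2}`). [folklore] -/
theorem log_coth_le_diagBB {ε : ℝ} (hε : 0 < ε) :
    Real.log (Real.cosh ε / Real.sinh ε) ≤ Real.log (1 / ε) + ε ^ 2 / 2 := by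
  have hsh : 0 < Real.sinh ε := Real.sinh_pos_iff.2 hε
  have hch : 0 < Real.cosh ε := Real.cosh_pos ε
  have h1 : Real.cosh ε / Real.sinh ε ≤ Real.exp (ε ^ 2 / 2) / ε :=
    calc Real.cosh ε / Real.sinh ε ≤ Real.cosh ε / ε :=
          div_le_div_of_nonneg_left hch.le hε (Real.self_le_sinh_iff.2 hε.le)
      _ ≤ Real.exp (ε ^ 2 / 2) / ε := div_le_div_of_nonneg_right (Real.cosh_le_exp_half_sq ε) hε.le
  calc Real.log (Real.cosh ε / Real.sinh ε) ≤ Real.log (Real.exp (ε ^ 2 / 2) / ε) :=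
        Real.log_le_log (by positivity) h1
    _ = Real.log (1 / ε) + ε ^ 2 / 2 := by
        rw [Real.log_div (Real.exp_pos _).ne' hε.ne', Real.log_exp, Real.log_div one_ne_zero hε.ne',
          Real.log_one]
        ring

/-- `1/sinh y ≤ 1/y` for `y > 0`. [folklore] -/
theorem inv_sinh_le_inv_diagBB {y : ℝ} (hy : 0 < y) : (Real.sinh y)⁻¹ ≤ y⁻¹ :=
  inv_anti₀ hy (Real.self_le_sinh_iff.2 hy.le)

/-- `(1 − y²/2)/y ≤ 1/sinh y` for `y > 0` (`sinh y ≤ y cosh y ≤ y e^{y²/2}` and `e^{−y²/2} ≥ 1 − y²/2`). [folklore] -/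
theorem inv_sinh_ge_diagBB {y : ℝ} (hy : 0 < y) : (1 - y ^ 2 / 2) * y⁻¹ ≤ (Real.sinh y)⁻¹ := by
  have hsh : 0 < Real.sinh y := Real.sinh_pos_iff.2 hy
  have h1 : Real.sinh y ≤ y * Real.exp (y ^ 2 / 2) :=
    (Literature.Barriers.HubbardSuperconductivity.sinh_le_self_mul_cosh hy.le).trans (mul_le_mul_of_nonneg_left (Real.cosh_le_exp_half_sq y) hy.le)
  have h2 : 1 - y ^ 2 / 2 ≤ Real.exp (-(y ^ 2 / 2)) := by
    have := Real.add_one_le_exp (-(y ^ 2 / 2))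
    linarith
  calc (1 - y ^ 2 / 2) * y⁻¹ ≤ Real.exp (-(y ^ 2 / 2)) * y⁻¹ :=
        mul_le_mul_of_nonneg_right h2 (inv_nonneg.2 hy.le)
    _ = (y * Real.exp (y ^ 2 / 2))⁻¹ := by rw [Real.exp_neg, mul_inv, mul_comm]
    _ ≤ (Real.sinh y)⁻¹ := inv_anti₀ hsh h1

/-- `e^{y/2} − 1 ≤ (y/2) e^{y/2}` (from `1 − y/2 ≤ e^{−y/2}`). [folklore] -/
theorem exp_half_sub_one_le_diagBB (y : ℝ) : Real.exp (y / 2) - 1 ≤ y / 2 * Real.exp (y / 2) := by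
  have h := Real.add_one_le_exp (-(y / 2))
  have hpos := Real.exp_pos (y / 2)
  have hprod : Real.exp (-(y / 2)) * Real.exp (y / 2) = 1 := by rw [← Real.exp_add]; simp
  nlinarith [mul_le_mul_of_nonneg_right h hpos.le]

/-- `y/2 ≤ e^{y/2} − 1`. [folklore] -/
theorem half_le_exp_half_sub_one_diagBB (y : ℝ) : y / 2 ≤ Real.exp (y / 2) - 1 := by
  have := Real.add_one_le_exp (y / 2)
  linarith

/-! ### The bump and its autocorrelation `P₀(s) = ∫ φ₀(u) φ₀(u − s) du` -/

-- continuity of the real bump is `continuous_shapeBump` (`…BumpCellBounds.lean`, reused).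

/-- The real bump vanishes off `[-1, 1]`. [folklore] -/
theorem support_bumpR_subset_diagBB : Function.support (fun u : ℝ => expNegInvGlue (1 - u ^ 2)) ⊆ Icc (-1) 1 := by
  intro u hu
  by_contra h
  apply hu
  have h1 : 1 - u ^ 2 ≤ 0 := by
    simp only [mem_Icc, not_and_or, not_le] at h
    rcases h with h | h <;> nlinarith
  exact expNegInvGlue.zero_of_nonpos h1

/-- The real bump has compact support. [folklore] -/
theorem hasCompactSupport_bumpR_diagBB : HasCompactSupport fun u : ℝ => expNegInvGlue (1 - u ^ 2) :=
  HasCompactSupport.of_support_subset_isCompact isCompact_Icc support_bumpR_subset_diagBB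

/-- `u ↦ φ₀(u) φ₀(u − s)` is integrable. [folklore] -/
theorem integrable_bumpR_mul_shift_diagBB (s : ℝ) :
    Integrable fun u : ℝ => expNegInvGlue (1 - u ^ 2) * expNegInvGlue (1 - (u - s) ^ 2) :=
  ((continuous_shapeBump.mul (continuous_shapeBump.comp (continuous_id.sub continuous_const))).integrable_of_hasCompactSupport
    (hasCompactSupport_bumpR_diagBB.mul_right))

/-- `N = ‖φ₀‖₂² = ∫ φ₀²` (the bump is real). [folklore] -/
theorem weilNorm2Sq_shapeBump_eq_integral_sq_diagBB :
    weilNorm2Sq (fun u : ℝ => ((expNegInvGlue (1 - u ^ 2) : ℝ) : ℂ)) = ∫ u, expNegInvGlue (1 - u ^ 2) ^ 2 := by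
  unfold weilNorm2Sq
  refine integral_congr_ae (Filter.Eventually.of_forall fun u => ?_)
  show ‖((expNegInvGlue (1 - u ^ 2) : ℝ) : ℂ)‖ ^ 2 = expNegInvGlue (1 - u ^ 2) ^ 2
  rw [Complex.norm_real, Real.norm_eq_abs, sq_abs]

/-- `0 ≤ P₀(s)`. [folklore] -/
theorem bumpAutocorr_nonneg_diagBB (s : ℝ) :
    0 ≤ ∫ u, expNegInvGlue (1 - u ^ 2) * expNegInvGlue (1 - (u - s) ^ 2) :=
  integral_nonneg fun _ => mul_nonneg (expNegInvGlue.nonneg _) (expNegInvGlue.nonneg _)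

/-- `P₀(s) ≤ N` (`2ab ≤ a² + b²` and translation invariance). [folklore] -/
theorem bumpAutocorr_le_diagBB (s : ℝ) :
    ∫ u, expNegInvGlue (1 - u ^ 2) * expNegInvGlue (1 - (u - s) ^ 2) ≤
      weilNorm2Sq (fun u : ℝ => ((expNegInvGlue (1 - u ^ 2) : ℝ) : ℂ)) := by
  rw [weilNorm2Sq_shapeBump_eq_integral_sq_diagBB]
  have hsq : Integrable fun u : ℝ => expNegInvGlue (1 - u ^ 2) ^ 2 := by
    simpa [sq] using integrable_bumpR_mul_shift_diagBB 0
  have hsq' : Integrable fun u : ℝ => expNegInvGlue (1 - (u - s) ^ 2) ^ 2 := hsq.comp_sub_right s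
  have hshift : ∫ u, expNegInvGlue (1 - (u - s) ^ 2) ^ 2 = ∫ u, expNegInvGlue (1 - u ^ 2) ^ 2 :=
    integral_sub_right_eq_self (fun u => expNegInvGlue (1 - u ^ 2) ^ 2) s
  have hle : ∫ u, expNegInvGlue (1 - u ^ 2) * expNegInvGlue (1 - (u - s) ^ 2) ≤
      ∫ u, (expNegInvGlue (1 - u ^ 2) ^ 2 + expNegInvGlue (1 - (u - s) ^ 2) ^ 2) / 2 := by
    refine integral_mono (integrable_bumpR_mul_shift_diagBB s) ((hsq.add hsq').div_const 2) fun u => ?_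
    show _ ≤ _
    nlinarith [sq_nonneg (expNegInvGlue (1 - u ^ 2) - expNegInvGlue (1 - (u - s) ^ 2))]
  refine hle.trans (le_of_eq ?_)
  rw [integral_div, integral_add hsq hsq', hshift]
  ring

/-- `P₀(s) = 0` for `|s| > 2` (the supports `[-1,1]` and `[s-1, s+1]` are disjoint). [folklore] -/
theorem bumpAutocorr_eq_zero_diagBB {s : ℝ} (hs : 2 < |s|) :
    ∫ u, expNegInvGlue (1 - u ^ 2) * expNegInvGlue (1 - (u - s) ^ 2) = 0 := by
  refine integral_eq_zero_of_ae (Filter.Eventually.of_forall fun u => ?_)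
  simp only [Pi.zero_apply]
  by_cases hu : expNegInvGlue (1 - u ^ 2) = 0
  · rw [hu, zero_mul]
  · have hu' : u ∈ Icc (-1 : ℝ) 1 := support_bumpR_subset_diagBB hu
    have hv : expNegInvGlue (1 - (u - s) ^ 2) = 0 := by
      by_contra hv
      have hv' : u - s ∈ Icc (-1 : ℝ) 1 := support_bumpR_subset_diagBB hv
      rw [mem_Icc] at hu' hv'
      have : |s| ≤ 2 := abs_le.2 ⟨by linarith, by linarith⟩
      linarith
    rw [hv, mul_zero]

/-- `P₀` is even (translation invariance of Lebesgue measure). [folklore] -/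
theorem bumpAutocorr_even_diagBB (s : ℝ) :
    ∫ u, expNegInvGlue (1 - u ^ 2) * expNegInvGlue (1 - (u - -s) ^ 2) =
      ∫ u, expNegInvGlue (1 - u ^ 2) * expNegInvGlue (1 - (u - s) ^ 2) := by
  have h : ∫ u, expNegInvGlue (1 - u ^ 2) * expNegInvGlue (1 - (u - -s) ^ 2) =
      ∫ u, (fun u => expNegInvGlue (1 - u ^ 2) * expNegInvGlue (1 - (u - -s) ^ 2)) (u - s) :=
    (integral_sub_right_eq_self (fun u => expNegInvGlue (1 - u ^ 2) * expNegInvGlue (1 - (u - -s) ^ 2)) s).symm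
  rw [h]
  refine integral_congr_ae (Filter.Eventually.of_forall fun u => ?_)
  have e : u - s - -s = u := by ring
  simp only [e]
  rw [mul_comm]

/-- `P₀(s) = Re (φ₀ ⋆ φ̃₀)(s)`: the bump autocorrelation is the real part of a Weil test, hence continuous and smooth.
[folklore] -/
theorem bumpAutocorr_eq_re_weilConv_diagBB (s : ℝ) :
    ∫ u, expNegInvGlue (1 - u ^ 2) * expNegInvGlue (1 - (u - s) ^ 2) =
      (weilConv (fun u : ℝ => ((expNegInvGlue (1 - u ^ 2) : ℝ) : ℂ))
        (weilReflect (fun u : ℝ => ((expNegInvGlue (1 - u ^ 2) : ℝ) : ℂ))) s).re := by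
  rw [weilConv_apply, ← Complex.reCLM_apply, ← Complex.reCLM.integral_comp_comm]
  · refine integral_congr_ae (Filter.Eventually.of_forall fun u => ?_)
    simp only [weilReflect, Complex.conj_ofReal, Complex.reCLM_apply, neg_sub, ← Complex.ofReal_mul,
      Complex.ofReal_re]
  · have h : (fun u : ℝ => ((expNegInvGlue (1 - u ^ 2) : ℝ) : ℂ) *
        weilReflect (fun u : ℝ => ((expNegInvGlue (1 - u ^ 2) : ℝ) : ℂ)) (s - u)) =
        fun u : ℝ => ((expNegInvGlue (1 - u ^ 2) * expNegInvGlue (1 - (u - s) ^ 2) : ℝ) : ℂ) := by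
      funext u
      simp only [weilReflect, Complex.conj_ofReal, neg_sub, Complex.ofReal_mul]
    rw [h]
    exact (integrable_bumpR_mul_shift_diagBB s).ofReal

/-- `P₀` is smooth (`C^∞`). [folklore] -/
theorem contDiff_bumpAutocorr_diagBB :
    ContDiff ℝ ∞ fun s : ℝ => ∫ u, expNegInvGlue (1 - u ^ 2) * expNegInvGlue (1 - (u - s) ^ 2) := by
  have hW : IsWeilTest (weilConv (fun u : ℝ => ((expNegInvGlue (1 - u ^ 2) : ℝ) : ℂ))
      (weilReflect (fun u : ℝ => ((expNegInvGlue (1 - u ^ 2) : ℝ) : ℂ)))) :=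
    weilComb_shapeBump_isWeilTest.weilConv weilComb_shapeBump_isWeilTest.weilReflect
  have e : (fun s : ℝ => ∫ u, expNegInvGlue (1 - u ^ 2) * expNegInvGlue (1 - (u - s) ^ 2)) =
      fun s => (weilConv (fun u : ℝ => ((expNegInvGlue (1 - u ^ 2) : ℝ) : ℂ))
        (weilReflect (fun u : ℝ => ((expNegInvGlue (1 - u ^ 2) : ℝ) : ℂ))) s).re :=
    funext bumpAutocorr_eq_re_weilConv_diagBB
  rw [e]
  exact Complex.reCLM.contDiff.comp hW.1

/-- `P₀` is continuous. [folklore] -/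
theorem continuous_bumpAutocorr_diagBB :
    Continuous fun s : ℝ => ∫ u, expNegInvGlue (1 - u ^ 2) * expNegInvGlue (1 - (u - s) ^ 2) :=
  contDiff_bumpAutocorr_diagBB.continuous

/-- **Lipschitz bound at the origin.** There is `K ≥ 0` with `N − P₀(s) ≤ K s` for `s ∈ [0, 2]`
(mean value theorem for the smooth `P₀`, `P₀(0) = N`). [folklore] -/
theorem exists_weilNorm2Sq_sub_bumpAutocorr_le_mul_diagBB : ∃ K : ℝ, 0 ≤ K ∧ ∀ s ∈ Icc (0 : ℝ) 2,
    weilNorm2Sq (fun u : ℝ => ((expNegInvGlue (1 - u ^ 2) : ℝ) : ℂ)) -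
        ∫ u, expNegInvGlue (1 - u ^ 2) * expNegInvGlue (1 - (u - s) ^ 2) ≤ K * s := by
  set P : ℝ → ℝ := fun s : ℝ => ∫ u, expNegInvGlue (1 - u ^ 2) * expNegInvGlue (1 - (u - s) ^ 2) with hP
  have hd : ContDiff ℝ ∞ P := contDiff_bumpAutocorr_diagBB
  have hcont : Continuous (deriv P) := hd.continuous_deriv (by simp)
  obtain ⟨K, hK⟩ := (isCompact_Icc (a := (0 : ℝ)) (b := 2)).exists_bound_of_continuousOn hcont.continuousOn
  have hK0 : 0 ≤ K := (norm_nonneg _).trans (hK 0 (left_mem_Icc.2 (by norm_num)))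
  refine ⟨K, hK0, fun s hs => ?_⟩
  have hdiff : ∀ y ∈ Icc (0 : ℝ) 2, DifferentiableAt ℝ P y := fun y _ => (hd.differentiable (by simp)) y
  have hmv := (convex_Icc (0 : ℝ) 2).norm_image_sub_le_of_norm_deriv_le hdiff (fun y hy => hK y hy)
    (left_mem_Icc.2 (by norm_num)) hs
  have hP0 : P 0 = weilNorm2Sq (fun u : ℝ => ((expNegInvGlue (1 - u ^ 2) : ℝ) : ℂ)) := by
    rw [weilNorm2Sq_shapeBump_eq_integral_sq_diagBB, hP]
    simp only [sub_zero, sq]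
  rw [sub_zero, Real.norm_eq_abs, Real.norm_eq_abs, abs_of_nonneg hs.1, hP0] at hmv
  have := neg_abs_le (P s - weilNorm2Sq (fun u : ℝ => ((expNegInvGlue (1 - u ^ 2) : ℝ) : ℂ)))
  linarith

/-- `∫ P₀ = I₀²` (Fubini: `MeasureTheory.integral_convolution` for `φ₀ ⋆ φ₀(−·)`). [folklore] -/
theorem integral_bumpAutocorr_diagBB :
    ∫ s, ∫ u, expNegInvGlue (1 - u ^ 2) * expNegInvGlue (1 - (u - s) ^ 2) =
      (∫ u, expNegInvGlue (1 - u ^ 2)) ^ 2 := by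
  have hfi : Integrable fun u : ℝ => expNegInvGlue (1 - u ^ 2) :=
    continuous_shapeBump.integrable_of_hasCompactSupport hasCompactSupport_bumpR_diagBB
  have e : (fun s : ℝ => ∫ u, expNegInvGlue (1 - u ^ 2) * expNegInvGlue (1 - (u - s) ^ 2)) =
      MeasureTheory.convolution (fun u : ℝ => expNegInvGlue (1 - u ^ 2))
        (fun v : ℝ => expNegInvGlue (1 - (-v) ^ 2)) (ContinuousLinearMap.mul ℝ ℝ) volume := by
    funext s
    rw [convolution_def]
    refine integral_congr_ae (Filter.Eventually.of_forall fun u => ?_)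
    simp only [ContinuousLinearMap.mul_apply', neg_sub]
  rw [e, integral_convolution (L := ContinuousLinearMap.mul ℝ ℝ) hfi (by simpa using hfi),
    ContinuousLinearMap.mul_apply']
  simp only [even_two, Even.neg_pow]
  rw [sq]

/-- `∫₀² P₀ = I₀²/2` (`P₀` is even, vanishes off `[-2, 2]`, and has total mass `I₀²`). [folklore] -/
theorem intervalIntegral_bumpAutocorr_eq_diagBB :
    ∫ s in (0 : ℝ)..2, ∫ u, expNegInvGlue (1 - u ^ 2) * expNegInvGlue (1 - (u - s) ^ 2) =
      (∫ u, expNegInvGlue (1 - u ^ 2)) ^ 2 / 2 := by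
  set P : ℝ → ℝ := fun s : ℝ => ∫ u, expNegInvGlue (1 - u ^ 2) * expNegInvGlue (1 - (u - s) ^ 2) with hP
  have hPc : Continuous P := continuous_bumpAutocorr_diagBB
  have hPz : ∀ s, 2 < |s| → P s = 0 := fun s hs => bumpAutocorr_eq_zero_diagBB hs
  have hPi : Integrable P := by
    refine hPc.integrable_of_hasCompactSupport
      (HasCompactSupport.of_support_subset_isCompact (isCompact_Icc (a := -2) (b := 2)) ?_)
    intro s hs
    by_contra h
    rw [mem_Icc, not_and_or, not_le, not_le] at h
    exact hs (hPz s (by rcases h with h | h <;> [rw [abs_of_neg (by linarith)]; rw [abs_of_pos (by linarith)]] <;>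
      linarith))
  -- `∫ P = ∫_{Iic 0} P + ∫_{Ioi 0} P`, and `∫_{Iic 0} P = ∫_{Ioi 0} P` by evenness
  have htot : ∫ s, P s = (∫ u, expNegInvGlue (1 - u ^ 2)) ^ 2 := integral_bumpAutocorr_diagBB
  have hsplit : ∫ s, P s = (∫ s in Iic (0 : ℝ), P s) + ∫ s in Ioi (0 : ℝ), P s :=
    (intervalIntegral.integral_Iic_add_Ioi hPi.integrableOn hPi.integrableOn).symm
  have heven : ∫ s in Iic (0 : ℝ), P s = ∫ s in Ioi (0 : ℝ), P s := by
    have h1 := integral_comp_neg_Ioi 0 P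
    rw [neg_zero] at h1
    rw [← h1]
    refine setIntegral_congr_fun measurableSet_Ioi fun s _ => ?_
    exact bumpAutocorr_even_diagBB s
  -- `∫_{Ioi 0} P = ∫₀² P`
  have hIoi : ∫ s in Ioi (0 : ℝ), P s = ∫ s in (0 : ℝ)..2, P s := by
    rw [intervalIntegral.integral_of_le (by norm_num : (0 : ℝ) ≤ 2), ← Ioc_union_Ioi_eq_Ioi (by norm_num : (0:ℝ) ≤ 2),
      setIntegral_union Ioc_disjoint_Ioi_same measurableSet_Ioi hPi.integrableOn hPi.integrableOn]
    have h0 : ∫ s in Ioi (2 : ℝ), P s = 0 :=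
      setIntegral_eq_zero_of_forall_eq_zero fun s hs => hPz s (by rw [abs_of_pos (by linarith [mem_Ioi.1 hs])]; exact hs)
    rw [h0, add_zero]
  have : 2 * ∫ s in (0 : ℝ)..2, P s = (∫ u, expNegInvGlue (1 - u ^ 2)) ^ 2 := by
    rw [← htot, hsplit, heven, hIoi]
    ring
  linarith

end Summit.RiemannHypothesis.RiemannHypothesis.Theorems.WeilCombBohrFejer

end
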